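import Mathlib.Analysis.SpecialFunctions.Complex.CircleAddChar
import Mathlib.NumberTheory.LegendreSymbol.AddCharacter
import Mathlib.Analysis.Calculus.ContDiff.Defs
import Literature.NumberTheory.LFunctions.DirichletLogDerivDisc
import Literature.NumberTheory.LFunctions.ExplicitFormulaPsiChar
import Literature.NumberTheory.LFunctions.DirichletCharacterCRT
import Literature.NumberTheory.LFunctions.PrimitiveQuadraticCharacterModulus
import Literature.NumberTheory.LFunctions.QuadraticCharacterShiftSumsLocal
import Literature.NumberTheory.Sieve.DivisorBound
import Literature.Barriers.Parity.SiegelZeroDichotomy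
import Literature.NumberTheory.LFunctions.BondarenkoHeap2026Section2
import HarnessLib

/-!
# Bondarenko–Heap 2026, §3 «Auxiliary results», §4 «The denominator `I₀`» (Lemma 4) and
# §5 «The numerator `J`: diagonal terms» (Propositions 5–6, Theorem 4 from them)

LABEL (C5 / rh-crit-ah, LADDER-RH §4 HELD «conditional bridges: exceptional zero ⇒ …»):
**NOT RH-BEARING.** Everything in this module is RH-FREE literature: a zero-density estimate for
Dirichlet `L`-functions (Chen–Gupta–Li, quoted by Bondarenko–Heap as their Proposition 2), the
Heath-Brown "`χ(p) = −1` almost always" lemma (their Proposition 3), and the complete character-sum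
lemma behind the off-diagonal of the mean square `I₀` (their Lemma 4 with its displays (11)–(14),
(16)), and the diagonal/off-diagonal split `J = 𝒟 + 𝒪𝒟` of the prime sum `J` of their Theorem 4
with Propositions 5–6 ((17), (18)) and the PROVED deduction «Prop 5 ∧ Prop 6 ⇒ Theorem 4». No
`RiemannHypothesis` occurs here (the exceptional character of Proposition 5 / Theorem 4 is the
tree's `IsSiegelZero`, a hypothesis); no gap statement. Typing a printed auxiliary result is
transcription, not progress toward RH; nothing here bears on the truth of RH.

Topic `Literature/NumberTheory/LFunctions`; paper-internal objects live in the sub-namespace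
`Literature.NumberTheory.LFunctions.BondarenkoHeap2026`. This is the t2 slice (BH §§3–5) of the
C5 corpus; the §5 statements consume the §2 dictionary of the sibling module
`BondarenkoHeap2026Section2` (`Bump`, `weight`/`weightHat` = `W_T`/`Ŵ_T`, `Resonator` with
`Resonator.T`/`lengthL`/`theta` = (5), `Resonator.G`/`Resonator.coeff`, `gWeight` = `g_h`,
`primeSum`/`J`, `cG` = `C_G`, `dG` = `D_G`, `sineIntegralCG`, `Jmain`, `I0main`, the facts
`cPhi_pos`/`weightHat_zero` = (3), and `theorem4`) — nothing of §2 is re-declared here.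

## What the source prints (A. Bondarenko, W. Heap, *Siegel zeros and small gaps between zeros of
## the Riemann zeta function*, arXiv:2608.07399v1 (7 Aug 2026); page = printed page, `l.` = line of
## the arXiv TeX source `Siegel_zeros_and_small_gaps_v5.tex`, held at `rh-crit/ah/src-arxiv-2608.07399v1/`)

§3 (p. 9, l.429–461). "Let `N(σ, H, ψ)` denote the number of zeros of `L(s, ψ)` in the region
`{ρ = β + iγ : β > σ, |γ| ⩽ H}`. **Proposition 2.** For `1/2 ⩽ σ < 1`, `H ⩾ 1`, and every `ε > 0`,
(9) `∑*_{ψ mod q} N(σ, H, ψ) ≪_ε (qH)^{7(1−σ)/3+ε}` where the sum is restricted to primitive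
characters modulo `q`. This is due to Chen–Gupta–Li [4] which utilises the machinery of
Guth–Maynard [13]." (Chen–Gupta–Li, arXiv:2507.08296, Theorem 1.2 "In all cases":
`∑_{χ mod q} N(σ,T,χ) ≤ (qT)^{o(1)}(q^{7(1−σ)/3} T^{2(1−σ)} + (qT)^{30(1−σ)/13})` for `1/2 < σ < 1`,
`N(σ,T,χ)` = zeros with `σ ≤ β ≤ 1`, `|t| ≤ T`, ALL characters mod `q`; (9) follows since
`2, 30/13 < 7/3`.) "Our second input is a result of Heath-Brown [14] (Lemma 3) …
**Proposition 3.** Let `β = 1 − (𝓔 log q)^{−1}` be a real zero of `L(s, χ)`, with `𝓔 ⩾ 3`. Then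
(10) `∑_{p ⩽ q^{500}, χ(p) = 1} (log p)/p ≪ (log q)/√(log 𝓔)` where the implied constant is
absolute." (Context, §2.3 p. 7–8, l.347–352: "Let `q` be a fundamental discriminant, large …
where `χ` is the primitive quadratic character modulo `q`"; Definition 1, p. 1–2: a Siegel zero of
quality `𝓔 ⩾ 3`.)

§4 (p. 10–12, l.465–614). "(11) `q = 2^ν Q`, `ν ∈ {0, 2, 3}`, `Q` odd and square-free." …
"`‖V‖_BV = ‖V‖_∞ + ∫_ℝ |V′(x)| dx`. **Lemma 4.** Let `k, r` be nonzero integers and let `V` be a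
smooth weight supported on a dyadic interval `m ≍ M` with `‖V‖_BV ≪ q^ε`. Then
(12) `∑_m V(m)χ(m)χ(km + r) ≪_ε q^ε {M(r,Q)/q + √(q(r,Q))}`." Proof displays: the completion
(13) `(S_q(k,r;0)/q) ∑_n V(n) + (1/q) ∑_{b=1}^{q−1} S_q(k,r;b) ∑_n V(n) e(bn/q)` with
`S_q(k,r;b) = ∑_{a mod q} χ_q(a) χ_q(ak + r) e(−ab/q)`, and
(14) `|S_q(k,r;0)| ≪ q^ε (r,Q)`, `|S_q(k,r;b)| ≪ q^{1/2+ε} (r,b,Q)^{1/2}` (`b ≠ 0`). Proof of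
Theorem 3: (16) `∑_{0<|r|⩽R} (r,Q)^α ≪_ε R q^ε` (`α = 1/2` or `1`), "which follows by expanding over
divisors of `Q` and applying the divisor bound `d(q) ≪ q^ε`".

§5 (p. 13–14, l.616–704). "Our goal in this section and the following is to understand
`J = ∑_{m,n ⩽ L, k ⩾ 2} Λ(k)g_h(k)χ(m)χ(n)G(m)G(n)/√(kmn) · Ŵ_T(log(n/km)/2π)`. We write `J = 𝒟 + 𝒪𝒟`
where `𝒟` is the sum with terms `km = n` and `𝒪𝒟` is the remaining off-diagonal sum.
**Proposition 5.** Assume that `χ` is an exceptional character of quality `𝓔`. Then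
`𝒟 = −(1 + o(1) + O(1/√log 𝓔)) Ŵ_T(0) (φ(q)/q) log L ∫₀¹ C_G(u) sin(πcϑu)/u du` where
`C_G(u) = ∫₀^{1−u} G₀(x)G₀(x+u) dx` and `ϑ = log L/log T`. **Proposition 6.** We have
`𝒪𝒟 = o(T (φ(q)/q) log T)`. Combining these two propositions gives Theorem 4." Proof of
Proposition 5: `𝒟 = Ŵ_T(0) ∑_{km ⩽ L} Λ(k)χ(k)χ(m)²G(m)G(km)/(km) · sin(πc log k/log T)/log k`;
(17) `∑_{m ⩽ L/p, (m,q)=1} G(m)G(pm)/m = C_G(log p/log L)(φ(q)/q) log L + O((log log q)²)`;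
(18) `∑_{p ⩽ L} (1/p) C_G(log p/log L) sin(πc log p/log T) ∼ ∫₀¹ C_G(u) sin(πcϑu)/u du`; and
Proposition 3 "to justify replacing `χ(p)` by `−1`".

## Lean rendering / design choices

* `N(σ, H, ψ)` = `charZeroCountRe ψ σ H`, the `finsum` of the tree's multiplicity
  `DirichletDisc.zeroOrder ψ ρ` over `{ρ | L(ρ, ψ) = 0, σ < Re ρ, |Im ρ| ≤ H}`; for `ψ ≠ χ₀` and
  `σ ≥ 0` this set lies in the tree's finite box `lfunctionZeroBox ψ H` (PROVED:
  `zeroSetRe_subset_lfunctionZeroBox`, `zeroSetRe_finite`), so the `finsum` is a genuine count.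
  "`≪_ε`" = `∀ ε > 0, ∃ C > 0, …` with `C` before all other data (uniform in `q, σ, H`).
* Proposition 3 is typed with its hypotheses EXPLICIT and as printed (`χ` primitive quadratic,
  `3 ≤ 𝓔`, `L(1 − 1/(𝓔 log q), χ) = 0`; "`p ⩽ q^{500}`, `χ(p) = 1`" as a filter of
  `Finset.Iic (q ^ 500)`), cited to Heath-Brown 1983, Lemma 3, AS QUOTED by Bondarenko–Heap (the
  1983 text is not held: acquisition acq-00505 is cite-only); the proved corollary
  `prop3_of_isSiegelZero` feeds it from the tree's `Literature.Barriers.Parity.IsSiegelZero χ 𝓔`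
  (same normalisation `β = 1 − 1/(𝓔 log q)`, threshold `10 ≤ 𝓔 ⇒ 3 ≤ 𝓔`).
* (11) is PROVED (`modulus_eq_two_pow_mul_odd_squarefree`) from the tree's
  `PrimitiveQuadratic.squarefree_of_isPrimitive_of_isQuadratic`,
  `eq_two_or_three_of_isPrimitive_two_pow` (QuadraticCharacterShiftSumsLocal) and the CRT components
  (`DirichletCharacterCRT.lean`); Lemma 4 and (14), (16) then quantify over a decomposition
  `q = 2^ν Q`, `Q` odd, so that `(r, Q)` is the printed gcd with the odd part.
* `S_q(k, r; b)` = `twistedShiftSum χ k r b` with Mathlib's `ZMod.stdAddChar` for `e(·/q)`;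
  at `b = 0` it is the tree's `shiftSum χ χ k r` (`twistedShiftSum_zero`). The completion identity
  (13) is PROVED (`completion_identity`, all `b mod q`; `completion_identity_split`, the printed
  `b = 0` / `b ≠ 0` split) by orthogonality of `ZMod.stdAddChar` (`AddChar.sum_mulShift`).
* `‖V‖_BV` = `bvNorm V := (⨆ x, ‖V x‖) + ∫ ‖deriv V‖` for `V : ℝ → ℂ` (smooth compactly supported
  weights, so the `iSup` is a genuine sup). Lemma 4's "`‖V‖_BV ≪ q^ε … ≪_ε q^ε`" is typed with the
  `ε`-convention made explicit and SAFE: for every `ε > 0` and aspect constant `A ≥ 1` (support in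
  `[M/A, AM]`, `‖V‖_BV ≤ A q^δ`) there are `δ = δ(ε, A) > 0` and `C`; the printed proof gives
  `δ = ε/2` (the `q^ε` of (14) is genuinely spent), so the same-letter reading would over-claim.
  The sum over `m` runs over the positive integers `1 ≤ m ≤ ⌊AM⌋` (the support is in `(0, ∞)`).
* (16) is PROVED for `α = 1` over `1 ≤ r ≤ R` (`gcd_sum_le`: `∑_{r ≤ R} (r, Q) ≤ R·d(Q)`, then the
  tree's divisor bound `Sieve.exists_card_divisors_le_mul_rpow`), and the printed two-sided /
  `α ∈ {1/2, 1}` form `eq16` is PROVED from it (`eq16_holds`).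
* §5. `jTerm` is the summand of the sibling's `primeSum` (so `J = ∑_m ∑_n ∑'_k jTerm`,
  `J_eq_sum_jTerm`, by `rfl`); `𝒟 = diagD` is "the sum with terms `km = n`" (for `m, n ⩽ L` there is
  at most one such `k`, namely `n/m` when `m ∣ n`), and `𝒪𝒟 = offDiagOD := J − 𝒟` ("the remaining
  off-diagonal sum"), so `J = 𝒟 + 𝒪𝒟` is `J_eq_diagD_add_offDiagOD`. The natural scale
  `S(q) = Ŵ_T(0)·(φ(q)/q)·log L` is `scaleS` (`Jmain = S·∫₀¹C_G sin/u`, `I0main = D_G·S`, proved).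
* The `o(1)` / `O(1/√log 𝓔)` of Propositions 5–6 are typed ADDITIVELY ON THE NATURAL SCALE (cell
  ruling rh-crit/ah/STATUS.md 02:47:56Z): Prop 5 as `|𝒟 + Jmain| ≤ (η + A/√(log 𝓔))·S(q)` with the
  `O`-constant `A ≥ 0` chosen after the fixed data `(c, φ, B, δ, G₀, f₀)` (the print leaves the
  dependence open; BH write "absolute" only in Proposition 3) and `∀ η > 0, ∃ q₀` for `o(1)`;
  Prop 6 as `|𝒪𝒟| ≤ η · T·(φ(q)/q)·log T` for `q ≥ q₀(η)`, `χ` primitive quadratic mod `q`, with NO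
  exceptional-zero hypothesis (none is printed, l.644–648). The additive reading is implied by the
  printed relative one (multiply the constants by `|∫₀¹ C_G sin/u|`) and does not degenerate when
  that integral vanishes. "Exceptional character of quality `𝓔`" = the tree's `IsSiegelZero χ 𝓔`
  (same normalisation; threshold `10` for `3`, immaterial as `𝓔 → ∞`), as in the sibling's
  `theorem4`.
* «Combining these two propositions gives Theorem 4» is PROVED: `theorem4_additive_of_prop5_prop6`
  (additive form) and `theorem4_of_prop5_prop6 : prop5 → prop6 → cPhi_pos → weightHat_zero →
  theorem4` (the sibling's relative form, whose presupposition `∫₀¹ C_G sin/u ≠ 0` is its own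
  hypothesis); the inputs (3) (`Ŵ_T(0) = C_Φ T + O(1/T)`, `C_Φ > 0`) give `T(φ(q)/q) log T ≪ S(q)`
  via `log L = ϑ log T` (`theta_eq`).
* (17) and (18) (the two displayed steps of the proof of Proposition 5) are typed as named facts
  (`eq17`, `eq18`; (18) in the additive form `→`, which is what "∼" means when the limit may vanish).
* NOT here: (15) (the expansion of `I₀` — a provable `Ŵ_T`/Fubini identity, deferred) and the
  unnumbered estimates of the proof of Theorem 3; the proofs of Proposition 2 (Chen–Gupta–Li),
  Proposition 3 (Heath-Brown), (14)/Lemma 4 (Gauss sums / Weil's bound; `lemma4_of_eq14` is proved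
  in the sibling `…Sections3to5Proofs`), Propositions 5–6 and (17)–(18) — NAMED FACTS (the corpus
  FACT-LIST boundary, `rh-crit/ah/README.md` §4).

## References

* [BondarenkoHeap2026] A. Bondarenko, W. Heap, arXiv:2608.07399v1, §3 Propositions 2–3 (p. 9),
  §4 (11)–(14), Lemma 4, (16) (pp. 10–12), §5 Propositions 5–6, (17)–(18) (pp. 13–14).
  Unrefereed preprint: its own results are `[claim]`s.
* [ChenGuptaLi2025] B. Chen, V. Gupta, Y. C. Li, arXiv:2507.08296, Theorem 1.2.
* [Heathbrown1983] D. R. Heath-Brown, *Prime twins and Siegel zeros*, PLMS (3) 47 (1983) 193–224,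
  Lemma 3 (as quoted by Bondarenko–Heap, Proposition 3).
* [MontgomeryVaughan2007] H. L. Montgomery, R. C. Vaughan, *Multiplicative Number Theory I*, §9.3
  (conductors of real primitive characters).
-/

noncomputable section

open Finset Real Complex
open scoped ContDiff

namespace Literature.NumberTheory.LFunctions.BondarenkoHeap2026

open Literature.NumberTheory.LFunctions.DirichletDisc (zeroOrder)
open Literature.Barriers.Parity (IsSiegelZero)

/-! ### §3. The zero count `N(σ, H, ψ)` and Proposition 2 (Chen–Gupta–Li zero density) -/

/-- The zeros of `L(s, ψ)` in the region `{ρ = β + iγ : β > σ, |γ| ⩽ H}` (as a set; multiplicities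
are carried by `zeroOrder`). [cite: BondarenkoHeap2026, §3 p. 9] -/
def zeroSetRe {q : ℕ} [NeZero q] (ψ : DirichletCharacter ℂ q) (σ H : ℝ) : Set ℂ :=
  {ρ | ψ.LFunction ρ = 0 ∧ σ < ρ.re ∧ |ρ.im| ≤ H}

/-- Membership in `zeroSetRe`. [cite: BondarenkoHeap2026, §3 p. 9] -/
theorem mem_zeroSetRe {q : ℕ} [NeZero q] {ψ : DirichletCharacter ℂ q} {σ H : ℝ} {ρ : ℂ} :
    ρ ∈ zeroSetRe ψ σ H ↔ ψ.LFunction ρ = 0 ∧ σ < ρ.re ∧ |ρ.im| ≤ H :=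
  Iff.rfl

/-- **`N(σ, H, ψ)`**: "the number of zeros of `L(s, ψ)` in the region `{ρ = β + iγ : β > σ,
|γ| ⩽ H}`", counted with multiplicity (`finsum` of `zeroOrder ψ` over `zeroSetRe ψ σ H`; a
genuine finite count for `ψ ≠ χ₀`, `σ ≥ 0`, by `zeroSetRe_finite`). [cite: BondarenkoHeap2026, §3 p. 9] -/
def charZeroCountRe {q : ℕ} [NeZero q] (ψ : DirichletCharacter ℂ q) (σ H : ℝ) : ℕ :=
  ∑ᶠ ρ ∈ zeroSetRe ψ σ H, zeroOrder ψ ρ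

/-- For `ψ ≠ χ₀` and `σ ≥ 0` the region `{β > σ, |γ| ≤ H}` of zeros lies in the tree's box of
non-trivial zeros `lfunctionZeroBox ψ H` (`L(s, ψ) ≠ 0` for `Re s ≥ 1`; the non-trivial zeros are
those of the critical strip). [cite: MontgomeryVaughan2007, Corollary 10.8] -/
theorem zeroSetRe_subset_lfunctionZeroBox {q : ℕ} [NeZero q] {ψ : DirichletCharacter ℂ q}
    (hψ : ψ ≠ 1) {σ : ℝ} (hσ : 0 ≤ σ) (H : ℝ) :
    zeroSetRe ψ σ H ⊆ lfunctionZeroBox ψ H := by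
  rintro ρ ⟨h0, hσρ, hH⟩
  refine ⟨h0, lt_of_le_of_lt hσ hσρ, ?_, hH⟩
  by_contra hre
  exact DirichletCharacter.LFunction_ne_zero_of_one_le_re ψ (Or.inl hψ) (not_lt.mp hre) h0

/-- For `ψ ≠ χ₀` and `σ ≥ 0` the zero region `{β > σ, |γ| ≤ H}` is finite (it lies in the compact
part `[0, 1] × [−H, H]` of the critical strip and the zeros of the entire `L(s, ψ)` are isolated), so
`N(σ, H, ψ)` is a genuine count. [cite: MontgomeryVaughan2007, Corollary 10.8] -/
theorem zeroSetRe_finite {q : ℕ} [NeZero q] {ψ : DirichletCharacter ℂ q} (hψ : ψ ≠ 1) {σ : ℝ}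
    (hσ : 0 ≤ σ) (H : ℝ) : (zeroSetRe ψ σ H).Finite :=
  (lfunctionZeroBox_finite hψ H).subset (zeroSetRe_subset_lfunctionZeroBox hψ hσ H)

open Classical in
/-- **Bondarenko–Heap 2026, Proposition 2** (Chen–Gupta–Li zero-density estimate, exponent `7/3`):
"For `1/2 ⩽ σ < 1`, `H ⩾ 1`, and every `ε > 0`, (9) `∑*_{ψ mod q} N(σ, H, ψ) ≪_ε (qH)^{7(1−σ)/3+ε}`
where the sum is restricted to primitive characters modulo `q`." Rendered: for every `ε > 0` there
is `C > 0` such that for every modulus `q ≥ 1`, every `σ ∈ [1/2, 1)` and every `H ≥ 1`,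
`∑_{ψ mod q primitive} N(σ, H, ψ) ≤ C (qH)^{7(1−σ)/3+ε}`. A NAMED FACT (corpus FACT-LIST boundary);
the source attributes it to Chen–Gupta–Li, arXiv:2507.08296, Theorem 1.2 (`ChenGuptaLi2025`, "In all
cases" clause, all characters mod `q`, zeros with `σ ≤ β ≤ 1`; (9) follows as `2 < 7/3` and
`30/13 < 7/3`). Locator: BH26 Prop 2, eq. (9), §3, p. 9; TeX l.433–445.
[claim: BondarenkoHeap2026, status: under-review] -/
def prop2 : Prop :=
  ∀ ε : ℝ, 0 < ε → ∃ C : ℝ, 0 < C ∧ ∀ (q : ℕ) [NeZero q] (σ H : ℝ), 1 / 2 ≤ σ → σ < 1 → 1 ≤ H →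
    (∑ ψ : DirichletCharacter ℂ q with ψ.IsPrimitive, (charZeroCountRe ψ σ H : ℝ)) ≤
      C * ((q : ℝ) * H) ^ (7 * (1 - σ) / 3 + ε)

/-! ### §3. Proposition 3 (Heath-Brown 1983, Lemma 3: `χ(p) = −1` almost always) -/

open Classical in
/-- The primes `p ⩽ q^{500}` with `χ(p) = 1` (the summation range of (10)).
[cite: BondarenkoHeap2026, Proposition 3] -/
def mimicryPrimes {q : ℕ} (χ : DirichletCharacter ℂ q) : Finset ℕ :=
  (Finset.Iic (q ^ 500)).filter fun p => p.Prime ∧ χ (p : ZMod q) = 1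

/-- Membership in `mimicryPrimes`. [cite: BondarenkoHeap2026, Proposition 3] -/
theorem mem_mimicryPrimes {q : ℕ} {χ : DirichletCharacter ℂ q} {p : ℕ} :
    p ∈ mimicryPrimes χ ↔ p ≤ q ^ 500 ∧ p.Prime ∧ χ (p : ZMod q) = 1 := by
  classical
  simp [mimicryPrimes]

/-- **Bondarenko–Heap 2026, Proposition 3 = Heath-Brown 1983, Lemma 3** (as quoted by
Bondarenko–Heap): "Let `β = 1 − (𝓔 log q)^{−1}` be a real zero of `L(s, χ)`, with `𝓔 ⩾ 3`. Then
(10) `∑_{p ⩽ q^{500}, χ(p)=1} (log p)/p ≪ (log q)/√(log 𝓔)` where the implied constant is absolute."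
Here `χ` is the primitive quadratic character modulo `q` (§2.3). Rendered with the hypotheses
explicit and as printed: there is an absolute `C > 0` such that for every `q`, every primitive
quadratic `χ` mod `q`, every real `𝓔 ≥ 3` with `L(1 − 1/(𝓔 log q), χ) = 0`,
`∑_{p ⩽ q^{500}, p prime, χ(p) = 1} (log p)/p ≤ C (log q)/√(log 𝓔)`. A NAMED FACT (corpus
FACT-LIST boundary; the 1983 text is cite-only, acq-00505). Locator: BH26 Prop 3, eq. (10), §3, p. 9;
TeX l.449–460. [cite: Heathbrown1983, Lemma 3] -/
def prop3 : Prop :=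
  ∃ C : ℝ, 0 < C ∧ ∀ (q : ℕ) [NeZero q] (χ : DirichletCharacter ℂ q), χ.IsPrimitive →
    χ.IsQuadratic → ∀ E : ℝ, 3 ≤ E → χ.LFunction ((1 - 1 / (E * Real.log q) : ℝ) : ℂ) = 0 →
      ∑ p ∈ mimicryPrimes χ, Real.log p / p ≤ C * Real.log q / Real.sqrt (Real.log E)

/-- **Proposition 3 for the tree's Siegel zeros**: a Siegel zero of quality `𝓔` in the sense of
`Literature.Barriers.Parity.IsSiegelZero χ 𝓔` (`χ` primitive quadratic, `10 ≤ 𝓔`,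
`L(1 − 1/(𝓔 log q), χ) = 0` — the SAME normalisation as Bondarenko–Heap's Definition 1, with the
threshold `10` in place of `3`) satisfies (10). PROVED from `prop3` (`10 ≤ 𝓔 ⇒ 3 ≤ 𝓔`).
[cite: BondarenkoHeap2026, Proposition 3] -/
theorem prop3_of_isSiegelZero (h : prop3) :
    ∃ C : ℝ, 0 < C ∧ ∀ (q : ℕ) [NeZero q] (χ : DirichletCharacter ℂ q) (E : ℝ), IsSiegelZero χ E →
      ∑ p ∈ mimicryPrimes χ, Real.log p / p ≤ C * Real.log q / Real.sqrt (Real.log E) := by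
  obtain ⟨C, hC, hmain⟩ := h
  refine ⟨C, hC, fun q _ χ E hS => ?_⟩
  exact hmain q χ hS.1 hS.2.1 E (by linarith [hS.2.2.1]) hS.2.2.2

/-! ### §4. (11): the shape of a fundamental discriminant modulus -/

/-- **(11)** "Since `q` is a fundamental discriminant it takes the form `q = 2^ν Q`,
`ν ∈ {0, 2, 3}`, `Q` odd and square-free" — for every modulus `q` carrying a primitive quadratic
character (the context of §2.3). PROVED from the tree: the CRT components of `χ` modulo `2^ν` and
`Q` are primitive quadratic (`DirichletCharacterCRT.lean`), a primitive quadratic character of odd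
modulus has square-free modulus (`PrimitiveQuadratic.squarefree_of_isPrimitive_of_isQuadratic`) and
one of modulus `2^ν`, `ν ≥ 1`, has `ν ∈ {2, 3}`
(`eq_two_or_three_of_isPrimitive_two_pow`). Locator: BH26 eq. (11), §4, p. 10; TeX l.476–479.
[cite: BondarenkoHeap2026, §4 (11)] -/
theorem modulus_eq_two_pow_mul_odd_squarefree {q : ℕ} [NeZero q] {χ : DirichletCharacter ℂ q}
    (hprim : χ.IsPrimitive) (hquad : χ.IsQuadratic) :
    ∃ ν Q : ℕ, q = 2 ^ ν * Q ∧ (ν = 0 ∨ ν = 2 ∨ ν = 3) ∧ Odd Q ∧ Squarefree Q := by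
  obtain ⟨ν, Q, hQodd, hq⟩ := Nat.exists_eq_two_pow_mul_odd (NeZero.ne q)
  subst hq
  have hQ0 : Q ≠ 0 := by rintro rfl; exact (Nat.not_odd_zero hQodd).elim
  haveI : NeZero Q := ⟨hQ0⟩
  haveI : NeZero (2 ^ ν) := ⟨pow_ne_zero _ two_ne_zero⟩
  have hcop : (2 ^ ν).Coprime Q := (Nat.coprime_two_left.mpr hQodd).pow_left ν
  refine ⟨ν, Q, rfl, ?_, hQodd, ?_⟩
  · rcases Nat.eq_zero_or_pos ν with hν | hν
    · exact Or.inl hν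
    · exact Or.inr (eq_two_or_three_of_isPrimitive_two_pow hν (crtFst hcop χ)
        (isPrimitive_crtFst hcop hprim) (IsQuadratic.crtFst hcop hquad))
  · exact PrimitiveQuadratic.squarefree_of_isPrimitive_of_isQuadratic hQodd
      (isPrimitive_crtSnd hcop hprim) (IsQuadratic.crtSnd hcop hquad)

/-! ### §4. The variation norm, the complete sums `S_q(k, r; b)`, the completion (13) -/

/-- **`‖V‖_BV = ‖V‖_∞ + ∫_ℝ |V′(x)| dx`** for a (smooth, compactly supported) weight `V : ℝ → ℂ`
(`iSup` of `‖V x‖` plus the `L¹` norm of `deriv V`). Locator: §4, p. 10; TeX l.488–491.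
[cite: BondarenkoHeap2026, §4 p. 10] -/
def bvNorm (V : ℝ → ℂ) : ℝ :=
  (⨆ x : ℝ, ‖V x‖) + ∫ x : ℝ, ‖deriv V x‖

/-- **`S_q(k, r; b) = ∑_{a mod q} χ_q(a) χ_q(ak + r) e(−ab/q)`** (the complete sums of the proof
of Lemma 4; `e(x/q)` is Mathlib's standard additive character `ZMod.stdAddChar` of `ZMod q`).
Locator: §4, p. 10; TeX l.516–520. [cite: BondarenkoHeap2026, §4 (13)] -/
def twistedShiftSum {q : ℕ} [NeZero q] (χ : DirichletCharacter ℂ q) (k r : ℤ) (b : ZMod q) : ℂ :=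
  ∑ a : ZMod q, χ a * χ (a * k + r) * ZMod.stdAddChar (-(a * b))

/-- At `b = 0`, `S_q(k, r; 0) = ∑_{a mod q} χ(a)χ(ka + r)` is the tree's complete shifted
correlation sum `shiftSum χ χ k r`. [cite: BondarenkoHeap2026, §4 (13)] -/
theorem twistedShiftSum_zero {q : ℕ} [NeZero q] (χ : DirichletCharacter ℂ q) (k r : ℤ) :
    twistedShiftSum χ k r 0 = shiftSum χ χ (k : ZMod q) (r : ZMod q) := by
  simp only [twistedShiftSum, shiftSum_def, mul_zero, neg_zero, AddChar.map_zero_eq_one, mul_one]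
  refine Finset.sum_congr rfl fun a _ => ?_
  rw [mul_comm a (k : ZMod q)]

/-- **The completion step (13), uniform form**: for any finitely supported weight,
`∑_n V(n) χ(n) χ(kn + r) = (1/q) ∑_{b mod q} S_q(k, r; b) ∑_n V(n) e(bn/q)` (orthogonality of the
additive characters mod `q`). PROVED. Locator: BH26 eq. (13), §4, p. 10; TeX l.508–515.
[cite: BondarenkoHeap2026, §4 (13)] -/
theorem completion_identity {q : ℕ} [NeZero q] (χ : DirichletCharacter ℂ q) (k r : ℤ)
    (S : Finset ℕ) (V : ℕ → ℂ) :
    ∑ n ∈ S, V n * χ (n : ZMod q) * χ ((k * n + r : ℤ) : ZMod q) =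
      (1 / (q : ℂ)) * ∑ b : ZMod q, twistedShiftSum χ k r b *
        ∑ n ∈ S, V n * ZMod.stdAddChar (b * (n : ZMod q)) := by
  classical
  have hq : (q : ℂ) ≠ 0 := Nat.cast_ne_zero.mpr (NeZero.ne q)
  -- orthogonality: `∑_b e(b(n - a)/q) = q [a = n]`
  have horth : ∀ a n : ZMod q,
      ∑ b : ZMod q, ZMod.stdAddChar (-(a * b)) * ZMod.stdAddChar (b * n) =
        if a = n then (q : ℂ) else 0 := by
    intro a n
    have h1 : ∀ b : ZMod q, ZMod.stdAddChar (-(a * b)) * ZMod.stdAddChar (b * n) =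
        ZMod.stdAddChar (b * (n - a)) := by
      intro b
      rw [← AddChar.map_add_eq_mul]
      congr 1
      ring
    simp_rw [h1]
    rw [AddChar.sum_mulShift (n - a) (ZMod.isPrimitive_stdAddChar q), ZMod.card q]
    by_cases h : a = n
    · simp [h]
    · have : n - a ≠ 0 := sub_ne_zero.mpr (Ne.symm h)
      simp [h, this]
  -- expand the right-hand side and exchange the sums
  have hrhs : ∑ b : ZMod q, twistedShiftSum χ k r b *
      ∑ n ∈ S, V n * ZMod.stdAddChar (b * (n : ZMod q)) =
      ∑ n ∈ S, V n * ∑ a : ZMod q, χ a * χ (a * k + r) *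
        ∑ b : ZMod q, ZMod.stdAddChar (-(a * b)) * ZMod.stdAddChar (b * (n : ZMod q)) := by
    simp only [twistedShiftSum, Finset.sum_mul, Finset.mul_sum]
    rw [Finset.sum_comm]
    refine Finset.sum_congr rfl fun n _ => ?_
    rw [Finset.sum_comm]
    refine Finset.sum_congr rfl fun a _ => ?_
    refine Finset.sum_congr rfl fun b _ => ?_
    ring
  rw [hrhs]
  simp_rw [horth]
  simp only [mul_ite, mul_zero, Finset.sum_ite_eq', Finset.mem_univ, if_true]
  rw [Finset.mul_sum]
  refine Finset.sum_congr rfl fun n _ => ?_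
  have hcast : ((k * n + r : ℤ) : ZMod q) = (n : ZMod q) * k + r := by push_cast; ring
  rw [hcast]
  field_simp

/-- **The completion step (13), as printed**: the `b = 0` term separated,
`∑_n V(n)χ(n)χ(kn + r) = (S_q(k,r;0)/q) ∑_n V(n) + (1/q) ∑_{b ≠ 0} S_q(k,r;b) ∑_n V(n) e(bn/q)`.
PROVED. [cite: BondarenkoHeap2026, §4 (13)] -/
theorem completion_identity_split {q : ℕ} [NeZero q] (χ : DirichletCharacter ℂ q) (k r : ℤ)
    (S : Finset ℕ) (V : ℕ → ℂ) :
    ∑ n ∈ S, V n * χ (n : ZMod q) * χ ((k * n + r : ℤ) : ZMod q) =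
      twistedShiftSum χ k r 0 / q * ∑ n ∈ S, V n +
      (1 / (q : ℂ)) * ∑ b ∈ (Finset.univ : Finset (ZMod q)).erase 0, twistedShiftSum χ k r b *
        ∑ n ∈ S, V n * ZMod.stdAddChar (b * (n : ZMod q)) := by
  classical
  rw [completion_identity, ← Finset.add_sum_erase _ _ (Finset.mem_univ (0 : ZMod q))]
  simp only [zero_mul, AddChar.map_zero_eq_one, mul_one, mul_add]
  ring

/-! ### §4. (14) and Lemma 4 (named facts), (16) (proved) -/

/-- **(14)** (the pointwise bounds for the complete sums, from the CRT factorisation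
`S_q = S_{2^ν} ∏ S_{p_i}`, the evaluation `∑_{a mod p} χ_p(a)χ_p(ak+1) = −χ_p(k)` and "a Gauss sum
or the Weil bound for a quadratic polynomial"): for `χ` the primitive quadratic character modulo
`q = 2^ν Q` (`Q` odd) and nonzero integers `k, r`,
`|S_q(k, r; 0)| ≪ q^ε (r, Q)` and `|S_q(k, r; b)| ≪ q^{1/2+ε} (r, b, Q)^{1/2}` (`b ≠ 0`).
Rendered: for every `ε > 0` there is `C > 0` with both bounds for all such data (`b` represented by
`b.val ∈ {1, …, q − 1}` inside the gcd). A NAMED FACT (internal to the proof of Lemma 4; FACT-LIST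
boundary). Locator: BH26 eq. (14), §4, p. 11; TeX l.546–550. [claim: BondarenkoHeap2026, status: under-review] -/
def eq14 : Prop :=
  ∀ ε : ℝ, 0 < ε → ∃ C : ℝ, 0 < C ∧
    ∀ (q : ℕ) [NeZero q] (χ : DirichletCharacter ℂ q), χ.IsPrimitive → χ.IsQuadratic →
    ∀ ν Q : ℕ, q = 2 ^ ν * Q → Odd Q → ∀ k r : ℤ, k ≠ 0 → r ≠ 0 →
      ‖twistedShiftSum χ k r 0‖ ≤ C * (q : ℝ) ^ ε * Int.gcd r Q ∧
      ∀ b : ZMod q, b ≠ 0 →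
        ‖twistedShiftSum χ k r b‖ ≤
          C * (q : ℝ) ^ (1 / 2 + ε) * Real.sqrt (Int.gcd (Int.gcd r b.val) Q)

/-- **Bondarenko–Heap 2026, Lemma 4** (completion lemma for `∑ χ(m)χ(km + r)` against a smooth
dyadic weight): "Let `k, r` be nonzero integers and let `V` be a smooth weight supported on a dyadic
interval `m ≍ M` with `‖V‖_BV ≪ q^ε`. Then (12)
`∑_m V(m)χ(m)χ(km + r) ≪_ε q^ε {M(r,Q)/q + √(q(r,Q))}`", `χ` the primitive quadratic character
modulo `q = 2^ν Q` (`Q` odd, (11)). Rendered (the `ε`-convention made explicit, see the module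
docstring): for every `ε > 0` and every aspect constant `A ≥ 1` there are `δ > 0` and `C > 0` such
that for all such `q, χ, ν, Q`, all nonzero `k, r`, all `M > 0` and all smooth `V : ℝ → ℂ`
supported in `[M/A, AM]` with `‖V‖_BV ≤ A q^δ`,
`|∑_{1 ≤ m ≤ AM} V(m)χ(m)χ(km + r)| ≤ C q^ε (M (r,Q)/q + √(q (r,Q)))`. A NAMED FACT (corpus
FACT-LIST boundary; its printed proof is (13) — proved above — plus (14) and partial summation).
Locator: BH26 Lemma 4, eq. (12), §4, p. 10; TeX l.495–505. [claim: BondarenkoHeap2026, status: under-review] -/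
def lemma4 : Prop :=
  ∀ ε : ℝ, 0 < ε → ∀ A : ℝ, 1 ≤ A → ∃ δ : ℝ, 0 < δ ∧ ∃ C : ℝ, 0 < C ∧
    ∀ (q : ℕ) [NeZero q] (χ : DirichletCharacter ℂ q), χ.IsPrimitive → χ.IsQuadratic →
    ∀ ν Q : ℕ, q = 2 ^ ν * Q → Odd Q → ∀ k r : ℤ, k ≠ 0 → r ≠ 0 →
    ∀ M : ℝ, 0 < M → ∀ V : ℝ → ℂ, ContDiff ℝ ∞ V → Function.support V ⊆ Set.Icc (M / A) (A * M) →
      bvNorm V ≤ A * (q : ℝ) ^ δ →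
        ‖∑ m ∈ Finset.Icc 1 ⌊A * M⌋₊, V m * χ (m : ZMod q) * χ ((k * m + r : ℤ) : ZMod q)‖ ≤
          C * (q : ℝ) ^ ε * (M * Int.gcd r Q / q + Real.sqrt (q * Int.gcd r Q))

/-- **The gcd sum behind (16)**: `∑_{1 ≤ r ≤ R} (r, Q) ≤ R · d(Q)` for `Q ≠ 0` ("expanding over
divisors of `Q`": `(r, Q)` is a divisor of `Q` dividing `r`, so the sum is at most
`∑_{d ∣ Q} d · #{r ≤ R : d ∣ r} ≤ ∑_{d ∣ Q} R`). PROVED. [cite: BondarenkoHeap2026, §4 (16)] -/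
theorem gcd_sum_le {Q : ℕ} (hQ : Q ≠ 0) (R : ℕ) :
    ∑ r ∈ Finset.Ioc 0 R, (Nat.gcd r Q : ℝ) ≤ R * Q.divisors.card := by
  classical
  -- `(r, Q) ≤ ∑_{d ∣ Q, d ∣ r} d`
  have hpt : ∀ r ∈ Finset.Ioc 0 R,
      (Nat.gcd r Q : ℝ) ≤ ∑ d ∈ Q.divisors, if d ∣ r then (d : ℝ) else 0 := by
    intro r _
    have hmem : Nat.gcd r Q ∈ Q.divisors := Nat.mem_divisors.mpr ⟨Nat.gcd_dvd_right r Q, hQ⟩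
    have hdr : Nat.gcd r Q ∣ r := Nat.gcd_dvd_left r Q
    calc (Nat.gcd r Q : ℝ) = ∑ d ∈ {Nat.gcd r Q}, if d ∣ r then (d : ℝ) else 0 := by
            simp [hdr]
      _ ≤ ∑ d ∈ Q.divisors, if d ∣ r then (d : ℝ) else 0 :=
            Finset.sum_le_sum_of_subset_of_nonneg (Finset.singleton_subset_iff.mpr hmem)
              (fun d _ _ => by split_ifs <;> positivity)
  refine (Finset.sum_le_sum hpt).trans ?_
  rw [Finset.sum_comm]
  -- for each `d ∣ Q`: `∑_{r ≤ R, d ∣ r} d = d · ⌊R/d⌋ ≤ R`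
  have hinner : ∀ d ∈ Q.divisors, (∑ r ∈ Finset.Ioc 0 R, if d ∣ r then (d : ℝ) else 0) ≤ R := by
    intro d _
    rw [← Finset.sum_filter, Finset.sum_const, nsmul_eq_mul, Nat.Ioc_filter_dvd_card_eq_div]
    have h : R / d * d ≤ R := Nat.div_mul_le_self R d
    exact_mod_cast h
  calc ∑ d ∈ Q.divisors, ∑ r ∈ Finset.Ioc 0 R, (if d ∣ r then (d : ℝ) else 0)
      ≤ ∑ d ∈ Q.divisors, (R : ℝ) := Finset.sum_le_sum hinner
    _ = R * Q.divisors.card := by rw [Finset.sum_const, nsmul_eq_mul]; ring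

/-- **(16)** "`∑_{0<|r|⩽R} (r, Q)^α ≪_ε R q^ε` (`α = 1/2` or `1`), which follows by expanding over
divisors of `Q` and applying the divisor bound `d(q) ≪ q^ε`", for `Q ∣ q` the odd part of the
modulus (or any nonzero divisor of `q`). Rendered: for every `ε > 0` there is `C > 0` such that for
all `q ≠ 0`, `Q ∣ q`, `R ∈ ℕ` and `α ∈ {1/2, 1}`, `∑_{r ∈ ℤ, 0 < |r| ≤ R} (r, Q)^α ≤ C R q^ε`.
PROVED below (`eq16_holds`). Locator: BH26 eq. (16), §4, p. 12; TeX l.602–607.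
[cite: BondarenkoHeap2026, §4 (16)] -/
def eq16 : Prop :=
  ∀ ε : ℝ, 0 < ε → ∃ C : ℝ, 0 < C ∧ ∀ q Q : ℕ, q ≠ 0 → Q ∣ q → ∀ (R : ℕ) (α : ℝ),
    (α = 1 / 2 ∨ α = 1) →
      ∑ r ∈ (Finset.Icc (-(R : ℤ)) R).erase 0, ((Int.gcd r Q : ℕ) : ℝ) ^ α ≤ C * R * (q : ℝ) ^ ε

/-- **(16) holds** (from `gcd_sum_le` and the tree's divisor bound
`Sieve.exists_card_divisors_le_mul_rpow`: `(r,Q)^α ≤ (r,Q)` as `(r,Q) ≥ 1`, the two signs of `r`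
give a factor `2`, and `d(Q) ≤ C_ε Q^ε ≤ C_ε q^ε`). [cite: BondarenkoHeap2026, §4 (16)] -/
theorem eq16_holds : eq16 := by
  intro ε hε
  obtain ⟨C, hC1, hdiv⟩ := Literature.NumberTheory.Sieve.exists_card_divisors_le_mul_rpow hε
  refine ⟨2 * C, by positivity, fun q Q hq hQq R α hα => ?_⟩
  classical
  have hQ0 : Q ≠ 0 := by rintro rfl; exact hq (Nat.eq_zero_of_zero_dvd hQq)
  set S : Finset ℤ := (Finset.Icc (-(R : ℤ)) R).erase 0 with hS
  have hα1 : α ≤ 1 := by rcases hα with rfl | rfl <;> norm_num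
  -- pointwise: `(r, Q)^α ≤ (r, Q) = (|r|, Q)`
  have hpt : ∀ r ∈ S, ((Int.gcd r Q : ℕ) : ℝ) ^ α ≤ (Nat.gcd r.natAbs Q : ℝ) := by
    intro r _
    have hg : Int.gcd r Q = Nat.gcd r.natAbs Q := by
      simp [Int.gcd, Int.natAbs_natCast]
    have hg1 : (1 : ℝ) ≤ ((Int.gcd r Q : ℕ) : ℝ) := by
      have : Int.gcd r Q ≠ 0 := fun h0 => hQ0 (by
        have := (Int.gcd_eq_zero_iff.mp h0).2; exact_mod_cast this)
      exact_mod_cast Nat.one_le_iff_ne_zero.mpr this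
    calc ((Int.gcd r Q : ℕ) : ℝ) ^ α ≤ ((Int.gcd r Q : ℕ) : ℝ) ^ (1 : ℝ) :=
          Real.rpow_le_rpow_of_exponent_le hg1 hα1
      _ = (Nat.gcd r.natAbs Q : ℝ) := by rw [Real.rpow_one, hg]
  -- the fibres of `r ↦ |r|` have at most two elements and land in `(0, R]`
  have himg : S.image Int.natAbs ⊆ Finset.Ioc 0 R := by
    intro n hn
    obtain ⟨r, hr, rfl⟩ := Finset.mem_image.mp hn
    obtain ⟨hr0, hrI⟩ := Finset.mem_erase.mp hr
    rw [Finset.mem_Icc] at hrI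
    rw [Finset.mem_Ioc]
    refine ⟨Int.natAbs_pos.mpr hr0, ?_⟩
    have : (r.natAbs : ℤ) ≤ R := by rw [Int.natCast_natAbs]; exact abs_le.mpr ⟨hrI.1, hrI.2⟩
    exact_mod_cast this
  have hfib : ∀ n : ℕ, ((S.filter fun r => r.natAbs = n).card : ℝ) ≤ 2 := by
    intro n
    have hsub : (S.filter fun r => r.natAbs = n) ⊆ {(n : ℤ), -(n : ℤ)} := by
      intro r hr
      have h := (Finset.mem_filter.mp hr).2
      rw [Finset.mem_insert, Finset.mem_singleton]
      rcases Int.natAbs_eq r with h' | h'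
      · exact Or.inl (by rw [h', h])
      · exact Or.inr (by rw [h', h])
    calc ((S.filter fun r => r.natAbs = n).card : ℝ)
        ≤ (({(n : ℤ), -(n : ℤ)} : Finset ℤ).card : ℝ) := by exact_mod_cast Finset.card_le_card hsub
      _ ≤ 2 := by exact_mod_cast Finset.card_le_two
  have hsum : ∑ r ∈ S, (Nat.gcd r.natAbs Q : ℝ) ≤ 2 * ∑ n ∈ Finset.Ioc 0 R, (Nat.gcd n Q : ℝ) := by
    rw [Finset.sum_comp (fun n : ℕ => (Nat.gcd n Q : ℝ)) Int.natAbs]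
    calc ∑ y ∈ S.image Int.natAbs, (S.filter fun r => r.natAbs = y).card • (Nat.gcd y Q : ℝ)
        ≤ ∑ y ∈ S.image Int.natAbs, 2 * (Nat.gcd y Q : ℝ) := by
          refine Finset.sum_le_sum fun y _ => ?_
          rw [nsmul_eq_mul]
          exact mul_le_mul_of_nonneg_right (hfib y) (by positivity)
      _ ≤ ∑ y ∈ Finset.Ioc 0 R, 2 * (Nat.gcd y Q : ℝ) :=
          Finset.sum_le_sum_of_subset_of_nonneg himg (fun _ _ _ => by positivity)
      _ = 2 * ∑ n ∈ Finset.Ioc 0 R, (Nat.gcd n Q : ℝ) := by rw [Finset.mul_sum]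
  -- assemble with the divisor bound and `Q ≤ q`
  have hdQ : (Q.divisors.card : ℝ) ≤ C * (Q : ℝ) ^ ε := hdiv Q hQ0
  have hQq' : (Q : ℝ) ≤ q := by exact_mod_cast Nat.le_of_dvd (Nat.pos_of_ne_zero hq) hQq
  calc ∑ r ∈ S, ((Int.gcd r Q : ℕ) : ℝ) ^ α ≤ ∑ r ∈ S, (Nat.gcd r.natAbs Q : ℝ) :=
        Finset.sum_le_sum hpt
    _ ≤ 2 * ∑ n ∈ Finset.Ioc 0 R, (Nat.gcd n Q : ℝ) := hsum
    _ ≤ 2 * (R * Q.divisors.card) := by gcongr; exact gcd_sum_le hQ0 R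
    _ ≤ 2 * (R * (C * (Q : ℝ) ^ ε)) := by gcongr
    _ ≤ 2 * (R * (C * (q : ℝ) ^ ε)) := by gcongr
    _ = 2 * C * R * (q : ℝ) ^ ε := by ring


/-! ### §5. The numerator `J`: the split `J = 𝒟 + 𝒪𝒟`, Propositions 5–6, Theorem 4 from them -/

/-- The summand of `J` (sibling `primeSum`):
`Λ(k) g_h(k) r(m) r(n)/√(kmn) · Ŵ_T(log(km/n)/2π)` with `h = 2πc/log T`.
[cite: BondarenkoHeap2026, Theorem 4 p. 8 (J)] -/
def jTerm (c : ℝ) (w : Bump) (B : ℕ) (r : ℕ → ℝ) (T : ℝ) (k m n : ℕ) : ℝ :=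
  ArithmeticFunction.vonMangoldt k * gWeight (gapWidth c T) k * r m * r n /
      Real.sqrt ((k : ℝ) * m * n) *
    weightHat w B T (Real.log ((k : ℝ) * m / n) / (2 * π))

/-- `J = ∑_{m ⩽ L} ∑_{n ⩽ L} ∑'_k jTerm k m n` (definitional unfolding of the sibling's `J`; the
length `L` only bounds the ranges of `m, n`).
[cite: BondarenkoHeap2026, Theorem 4 p. 8 (J)] -/
theorem J_eq_sum_jTerm (c : ℝ) (w : Bump) (B : ℕ) (ρ : Resonator) {q : ℕ}
    (χ : DirichletCharacter ℂ q) :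
    J c w B ρ χ = ∑ m ∈ Finset.Icc 1 ⌊lengthL q⌋₊, ∑ n ∈ Finset.Icc 1 ⌊lengthL q⌋₊,
      ∑' k : ℕ, jTerm c w B (ρ.coeff χ) (ρ.T q) k m n := rfl

open Classical in
/-- **`𝒟`**, "the sum with terms `km = n`" of `J` (§5, p. 13; TeX l.623–627): for `m, n ⩽ L` the
only possible `k` is `n/m` when `m ∣ n`. The paper then computes
`𝒟 = Ŵ_T(0) ∑_{km ⩽ L} Λ(k)χ(k)χ(m)²G(m)G(km)/(km) · sin(πc log k/log T)/log k`.
[cite: BondarenkoHeap2026, §5 p. 13 (𝒟)] -/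
def diagD (c : ℝ) (w : Bump) (B : ℕ) (ρ : Resonator) {q : ℕ} (χ : DirichletCharacter ℂ q) : ℝ :=
  ∑ m ∈ Finset.Icc 1 ⌊lengthL q⌋₊, ∑ n ∈ Finset.Icc 1 ⌊lengthL q⌋₊,
    if m ∣ n then jTerm c w B (ρ.coeff χ) (ρ.T q) (n / m) m n else 0

/-- **`𝒪𝒟`**, "the remaining off-diagonal sum": `𝒪𝒟 := J − 𝒟` (§5, p. 13; TeX l.623–627).
[cite: BondarenkoHeap2026, §5 p. 13 (𝒪𝒟)] -/
def offDiagOD (c : ℝ) (w : Bump) (B : ℕ) (ρ : Resonator) {q : ℕ} (χ : DirichletCharacter ℂ q) : ℝ :=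
  J c w B ρ χ - diagD c w B ρ χ

/-- **`J = 𝒟 + 𝒪𝒟`** (§5, p. 13). [cite: BondarenkoHeap2026, §5 p. 13 (J = 𝒟 + 𝒪𝒟)] -/
theorem J_eq_diagD_add_offDiagOD (c : ℝ) (w : Bump) (B : ℕ) (ρ : Resonator) {q : ℕ}
    (χ : DirichletCharacter ℂ q) : J c w B ρ χ = diagD c w B ρ χ + offDiagOD c w B ρ χ := by
  rw [offDiagOD]; ring

/-- In a diagonal term the Fourier weight is `Ŵ_T(0)`: for `m ∣ n`, `m ≥ 1`,
`log((n/m)·m/n) = 0` (`n ≥ 1`). [cite: BondarenkoHeap2026, §5 p. 13 (proof of Proposition 5, first display)] -/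
theorem jTerm_diag (c : ℝ) (w : Bump) (B : ℕ) (r : ℕ → ℝ) (T : ℝ) {m n : ℕ}
    (hn : 1 ≤ n) (hmn : m ∣ n) :
    jTerm c w B r T (n / m) m n =
      ArithmeticFunction.vonMangoldt (n / m) * gWeight (gapWidth c T) (n / m) * r m * r n /
        Real.sqrt (((n / m : ℕ) : ℝ) * m * n) * weightHat w B T 0 := by
  have hkm : (((n / m : ℕ) : ℝ) * m) = n := by exact_mod_cast Nat.div_mul_cancel hmn
  have hn0 : (n : ℝ) ≠ 0 := by exact_mod_cast (by omega : n ≠ 0)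
  rw [jTerm, hkm, div_self hn0, Real.log_one, zero_div]

/-- The natural scale `S(q) = Ŵ_T(0) · (φ(q)/q) · log L` of Theorems 3–4 and Propositions 5–6
(`T = q^{7/3+δ}`, `L = q^{17/6}`). [cite: BondarenkoHeap2026, Theorem 3 (6) and Theorem 4 p. 8] -/
def scaleS (w : Bump) (B : ℕ) (ρ : Resonator) (q : ℕ) : ℝ :=
  weightHat w B (ρ.T q) 0 * ((Nat.totient q : ℝ) / q) * Real.log (lengthL q)

/-- `Jmain = S(q) · ∫₀¹ C_G(u) sin(πcϑu)/u du`. [cite: BondarenkoHeap2026, Theorem 4 p. 8] -/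
theorem Jmain_eq_scaleS_mul (c : ℝ) (w : Bump) (B : ℕ) (ρ : Resonator) (q : ℕ) :
    Jmain c w B ρ q = scaleS w B ρ q * sineIntegralCG ρ.δ c ρ.G₀ := by
  rw [Jmain, scaleS]

/-- `I0main = D_G · S(q)`. [cite: BondarenkoHeap2026, Theorem 3 (6) p. 8] -/
theorem I0main_eq_dG_mul_scaleS (w : Bump) (B : ℕ) (ρ : Resonator) (q : ℕ) :
    I0main w B ρ q = dG ρ.G₀ * scaleS w B ρ q := by
  rw [I0main, scaleS]; ring

/-- **Bondarenko–Heap 2026, Proposition 5** (§5, p. 13; TeX l.630–642): "Assume that `χ` is an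
exceptional character of quality `𝓔`. Then
`𝒟 = −(1 + o(1) + O(1/√log 𝓔)) Ŵ_T(0) (φ(q)/q) log L ∫₀¹ C_G(u) sin(πcϑu)/u du` where
`C_G(u) = ∫₀^{1−u} G₀(x)G₀(x+u) dx` and `ϑ = log L/log T`." Typed additively on the natural scale
`S(q)` (module docstring): for `c > 0`, a bump, `B` and a resonator datum there is `A ≥ 0` such
that for every `η > 0` and all large `q`, every Siegel zero `(χ mod q, 𝓔)` in the tree's sense
(`IsSiegelZero`) has `|𝒟 + Jmain| ≤ (η + A/√(log 𝓔)) · S(q)`. No RH. CLAIM of an unrefereed source,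
NOT proved here (its proof is (17), (18) and Proposition 3). [claim: BondarenkoHeap2026, status: under-review] -/
def prop5 : Prop :=
  ∀ (c : ℝ), 0 < c → ∀ (w : Bump) (B : ℕ) (ρ : Resonator), ∃ A : ℝ, 0 ≤ A ∧ ∀ η : ℝ, 0 < η →
    ∃ q₀ : ℕ, ∀ (q : ℕ) [NeZero q] (χ : DirichletCharacter ℂ q) (E : ℝ), q₀ ≤ q → IsSiegelZero χ E →
      |diagD c w B ρ χ + Jmain c w B ρ q| ≤ (η + A / Real.sqrt (Real.log E)) * scaleS w B ρ q

/-- **Bondarenko–Heap 2026, Proposition 6** (§5, p. 13; TeX l.644–648): "We have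
`𝒪𝒟 = o(T (φ(q)/q) log T)`" (as `q → ∞` through the moduli of §2.3 — `q` a fundamental
discriminant, `χ` the primitive quadratic character mod `q`, `T = q^{7/3+δ}`, `L = q^{17/6}`, the
bump, `B`, `c > 0` and the resonator datum fixed; NO exceptional-zero hypothesis is printed or used).
Typed: for every `η > 0` there is `q₀` with `|𝒪𝒟| ≤ η · T · (φ(q)/q) · log T` for all `q ≥ q₀` and
every primitive quadratic `χ` mod `q`. No RH. CLAIM of an unrefereed source, NOT proved here (its
proof is §6: ranges I–III, sibling `BondarenkoHeap2026Section6`). [claim: BondarenkoHeap2026, status: under-review] -/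
def prop6 : Prop :=
  ∀ (c : ℝ), 0 < c → ∀ (w : Bump) (B : ℕ) (ρ : Resonator) (η : ℝ), 0 < η →
    ∃ q₀ : ℕ, ∀ (q : ℕ) [NeZero q] (χ : DirichletCharacter ℂ q), q₀ ≤ q → χ.IsPrimitive →
      χ.IsQuadratic →
        |offDiagOD c w B ρ χ| ≤ η * (ρ.T q * ((Nat.totient q : ℝ) / q) * Real.log (ρ.T q))

open Classical in
/-- **(17)** (proof of Proposition 5, p. 13; TeX l.662–668): "for the inner sum, arguing as before
we find `∑_{m ⩽ L/p, (m,q)=1} G(m)G(pm)/m = C_G(log p/log L) (φ(q)/q) log L + O((log log q)²)`"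
(uniformly in the prime `p ⩽ L`; the `O`-constant may depend on the resonator datum `(G₀, f₀)`).
Typed: for every resonator datum there are `K, q₀` with the displayed bound for all `q ≥ q₀` and all
primes `p ⩽ L = q^{17/6}`. A NAMED FACT (proof-internal display). [claim: BondarenkoHeap2026, status: under-review] -/
def eq17 : Prop :=
  ∀ (ρ : Resonator), ∃ K : ℝ, ∃ q₀ : ℕ, ∀ q : ℕ, q₀ ≤ q → ∀ p : ℕ, p.Prime → (p : ℝ) ≤ lengthL q →
    |(∑ m ∈ (Finset.Icc 1 ⌊lengthL q / p⌋₊).filter (fun m => Nat.Coprime m q),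
        ρ.G q m * ρ.G q (p * m) / m) -
      cG ρ.G₀ (Real.log p / Real.log (lengthL q)) * ((Nat.totient q : ℝ) / q) *
        Real.log (lengthL q)| ≤ K * Real.log (Real.log q) ^ 2

open Classical in
/-- **(18)** (proof of Proposition 5, p. 14; TeX l.683–689): "the prime number theorem and partial
summation give `∑_{p ⩽ L} (1/p) C_G(log p/log L) sin(πc log p/log T) ∼ ∫₀¹ C_G(u) sin(πcϑu)/u du`"
(`ϑ = log L/log T = ϑ_δ`, (5)). Typed in the additive form (the difference tends to `0` as
`q → ∞`; this is what "∼" asserts when the integral is nonzero and is its only meaningful reading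
otherwise): for every resonator datum, `c > 0` and `η > 0` there is `q₀` with
`|∑_{p ⩽ L} … − ∫₀¹ C_G(u) sin(πcϑ_δ u)/u du| ≤ η` for `q ≥ q₀`. A NAMED FACT (proof-internal
display). [claim: BondarenkoHeap2026, status: under-review] -/
def eq18 : Prop :=
  ∀ (ρ : Resonator) (c : ℝ), 0 < c → ∀ η : ℝ, 0 < η → ∃ q₀ : ℕ, ∀ q : ℕ, q₀ ≤ q →
    |(∑ p ∈ (Finset.Iic ⌊lengthL q⌋₊).filter Nat.Prime,
        1 / (p : ℝ) * cG ρ.G₀ (Real.log p / Real.log (lengthL q)) *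
          Real.sin (π * c * Real.log p / Real.log (ρ.T q))) -
      sineIntegralCG ρ.δ c ρ.G₀| ≤ η

/-! ### §5. «Combining these two propositions gives Theorem 4» (PROVED) -/

/-- `ϑ_δ = 17/(14 + 6δ) > 0`. [cite: BondarenkoHeap2026, §2.3 (5) p. 8] -/
theorem theta_pos (ρ : Resonator) : 0 < theta ρ.δ := by
  have := ρ.δ_pos
  unfold theta
  positivity

/-- `T = q^{7/3+δ} ≥ q` for `q ≥ 1`. [cite: BondarenkoHeap2026, §2.3 (5) p. 8] -/
theorem le_T (ρ : Resonator) {q : ℕ} (hq : 1 ≤ q) : (q : ℝ) ≤ ρ.T q := by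
  have hq1 : (1 : ℝ) ≤ q := by exact_mod_cast hq
  have h := Real.rpow_le_rpow_of_exponent_le hq1 (show (1 : ℝ) ≤ 7 / 3 + ρ.δ by linarith [ρ.δ_pos])
  rw [Real.rpow_one] at h
  exact h

/-- **The scale comparison** `T · (φ(q)/q) · log T ≤ (2/(C_Φ ϑ)) · S(q)` for `q` large, from (3)
(`Ŵ_T(0) ≥ C_Φ T − K/T ≥ C_Φ T/2` once `T² ≥ 2K/C_Φ`) and `log L = ϑ log T`.
[cite: BondarenkoHeap2026, §5 p. 13 ("Combining these two propositions gives Theorem 4")] -/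
theorem T_mul_le_scaleS (hC : cPhi_pos) (hW : weightHat_zero) (w : Bump) (B : ℕ) (ρ : Resonator) :
    ∃ q₁ : ℕ, ∀ q : ℕ, q₁ ≤ q →
      0 ≤ scaleS w B ρ q ∧
        ρ.T q * ((Nat.totient q : ℝ) / q) * Real.log (ρ.T q) ≤
          2 / (cPhi w B * theta ρ.δ) * scaleS w B ρ q := by
  obtain ⟨K, hK⟩ := hW w B
  have hCΦ : 0 < cPhi w B := hC w B
  have hϑ : 0 < theta ρ.δ := theta_pos ρ
  refine ⟨max 2 ⌈2 * K / cPhi w B⌉₊, fun q hq => ?_⟩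
  have hq2 : 2 ≤ q := le_trans (le_max_left _ _) hq
  have hqK : (⌈2 * K / cPhi w B⌉₊ : ℝ) ≤ q := by exact_mod_cast le_trans (le_max_right _ _) hq
  have hq1r : (1 : ℝ) ≤ q := by exact_mod_cast (by omega : 1 ≤ q)
  set T := ρ.T q with hT
  have hTq : (q : ℝ) ≤ T := le_T ρ (by omega)
  have hT1 : 1 ≤ T := hq1r.trans hTq
  have hT0 : 0 < T := by linarith
  -- Ŵ_T(0) ≥ C_Φ T / 2
  have hKT : K ≤ cPhi w B * T ^ 2 / 2 := by
    have h1 : 2 * K / cPhi w B ≤ q := (Nat.le_ceil _).trans hqK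
    have h2 : (q : ℝ) ≤ T ^ 2 := hTq.trans (by nlinarith)
    have h3 : 2 * K / cPhi w B ≤ T ^ 2 := h1.trans h2
    rw [div_le_iff₀ hCΦ] at h3
    linarith
  have hWlow : cPhi w B * T / 2 ≤ weightHat w B T 0 := by
    have h := hK T hT1
    have h' : cPhi w B * T - K * T⁻¹ ≤ weightHat w B T 0 := by
      linarith [(abs_le.mp h).1]
    have hKT' : K * T⁻¹ ≤ cPhi w B * T / 2 := by
      rw [← div_eq_mul_inv, div_le_iff₀ hT0]
      nlinarith
    linarith
  have hW0 : 0 ≤ weightHat w B T 0 := le_trans (by positivity) hWlow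
  have hφq : 0 ≤ ((Nat.totient q : ℝ) / q) := by positivity
  have hlogT : 0 ≤ Real.log T := Real.log_nonneg hT1
  have hlogL : Real.log (lengthL q) = theta ρ.δ * Real.log T := by
    have h := theta_eq ρ hq2
    have hlogT' : Real.log T ≠ 0 := (Real.log_pos (by linarith [hTq, (show (2:ℝ) ≤ q by exact_mod_cast hq2)])).ne'
    rw [hT] at hlogT' ⊢
    field_simp at h
    linarith [h]
  refine ⟨?_, ?_⟩
  · rw [scaleS, hlogL]; positivity
  · rw [scaleS, hlogL]
    have hcoef : T ≤ 2 / (cPhi w B * theta ρ.δ) * (weightHat w B T 0 * theta ρ.δ) := by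
      rw [div_mul_eq_mul_div, le_div_iff₀ (by positivity)]
      nlinarith [hWlow, hϑ]
    calc T * ((Nat.totient q : ℝ) / q) * Real.log T
        ≤ (2 / (cPhi w B * theta ρ.δ) * (weightHat w B T 0 * theta ρ.δ)) *
            ((Nat.totient q : ℝ) / q) * Real.log T := by gcongr
      _ = 2 / (cPhi w B * theta ρ.δ) *
            (weightHat w B T 0 * ((Nat.totient q : ℝ) / q) * (theta ρ.δ * Real.log T)) := by ring

/-- **Theorem 4 from Propositions 5 and 6, additive form** ("Combining these two propositions gives
Theorem 4", §5 p. 13; TeX l.649): `J = 𝒟 + 𝒪𝒟`, the triangle inequality, and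
`T(φ(q)/q) log T ≪ S(q)` (from (3): `Ŵ_T(0) = C_Φ T + O(1/T)`, `C_Φ > 0`, and `log L = ϑ log T`).
PROVED. [cite: BondarenkoHeap2026, Theorem 4 (proof: Propositions 5 and 6)] -/
theorem theorem4_additive_of_prop5_prop6 (h5 : prop5) (h6 : prop6) (hC : cPhi_pos)
    (hW : weightHat_zero) :
    ∀ (c : ℝ), 0 < c → ∀ (w : Bump) (B : ℕ) (ρ : Resonator), ∃ A : ℝ, 0 ≤ A ∧ ∀ η : ℝ, 0 < η →
      ∃ q₀ : ℕ, ∀ (q : ℕ) [NeZero q] (χ : DirichletCharacter ℂ q) (E : ℝ), q₀ ≤ q →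
        IsSiegelZero χ E →
          |J c w B ρ χ + Jmain c w B ρ q| ≤ (η + A / Real.sqrt (Real.log E)) * scaleS w B ρ q := by
  intro c hc w B ρ
  obtain ⟨A, hA, h5'⟩ := h5 c hc w B ρ
  obtain ⟨q₁, hq₁⟩ := T_mul_le_scaleS hC hW w B ρ
  have hCΦ : 0 < cPhi w B := hC w B
  have hϑ : 0 < theta ρ.δ := theta_pos ρ
  refine ⟨A, hA, fun η hη => ?_⟩
  obtain ⟨q₅, hq₅⟩ := h5' (η / 2) (by positivity)
  obtain ⟨q₆, hq₆⟩ := h6 c hc w B ρ (η / 2 * (cPhi w B * theta ρ.δ / 2)) (by positivity)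
  refine ⟨max q₁ (max q₅ q₆), fun q _ χ E hq hS => ?_⟩
  have hq1' : q₁ ≤ q := le_trans (le_max_left _ _) hq
  have hq5' : q₅ ≤ q := le_trans ((le_max_left _ _).trans (le_max_right _ _)) hq
  have hq6' : q₆ ≤ q := le_trans ((le_max_right _ _).trans (le_max_right _ _)) hq
  obtain ⟨hS0, hscale⟩ := hq₁ q hq1'
  have h5q := hq₅ q χ E hq5' hS
  have h6q := hq₆ q χ hq6' hS.1 hS.2.1
  rw [J_eq_diagD_add_offDiagOD]
  have hOD : |offDiagOD c w B ρ χ| ≤ η / 2 * scaleS w B ρ q := by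
    refine h6q.trans ?_
    calc η / 2 * (cPhi w B * theta ρ.δ / 2) * (ρ.T q * ((Nat.totient q : ℝ) / q) * Real.log (ρ.T q))
        ≤ η / 2 * (cPhi w B * theta ρ.δ / 2) * (2 / (cPhi w B * theta ρ.δ) * scaleS w B ρ q) := by
          gcongr
      _ = η / 2 * scaleS w B ρ q := by field_simp
  calc |diagD c w B ρ χ + offDiagOD c w B ρ χ + Jmain c w B ρ q|
      = |(diagD c w B ρ χ + Jmain c w B ρ q) + offDiagOD c w B ρ χ| := by ring_nf
    _ ≤ |diagD c w B ρ χ + Jmain c w B ρ q| + |offDiagOD c w B ρ χ| := abs_add_le _ _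
    _ ≤ (η / 2 + A / Real.sqrt (Real.log E)) * scaleS w B ρ q + η / 2 * scaleS w B ρ q :=
        add_le_add h5q hOD
    _ = (η + A / Real.sqrt (Real.log E)) * scaleS w B ρ q := by ring

/-- **Theorem 4 from Propositions 5 and 6** in the sibling's printed (relative) form `theorem4`
(`|J + Jmain| ≤ (η + A/√(log 𝓔))·|Jmain|` under its presupposition `∫₀¹ C_G sin/u ≠ 0`): from the
additive form with the constants divided by `|∫₀¹ C_G sin/u|`. PROVED — node BH26:Thm4glue.
[cite: BondarenkoHeap2026, Theorem 4 (proof: Propositions 5 and 6)] -/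
theorem theorem4_of_prop5_prop6 (h5 : prop5) (h6 : prop6) (hC : cPhi_pos)
    (hW : weightHat_zero) : theorem4 := by
  intro c hc w B ρ hK
  obtain ⟨A, hA, hadd⟩ := theorem4_additive_of_prop5_prop6 h5 h6 hC hW c hc w B ρ
  obtain ⟨q₁, hq₁⟩ := T_mul_le_scaleS hC hW w B ρ
  set k : ℝ := |sineIntegralCG ρ.δ c ρ.G₀| with hk
  have hk0 : 0 < k := abs_pos.mpr hK
  refine ⟨A / k, by positivity, fun η hη => ?_⟩
  obtain ⟨q₀, hq₀⟩ := hadd (η * k) (by positivity)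
  refine ⟨max q₀ q₁, fun q _ χ E hq hS => ?_⟩
  have h := hq₀ q χ E (le_trans (le_max_left _ _) hq) hS
  obtain ⟨hS0, -⟩ := hq₁ q (le_trans (le_max_right _ _) hq)
  have hJmain : |Jmain c w B ρ q| = scaleS w B ρ q * k := by
    rw [Jmain_eq_scaleS_mul, abs_mul, abs_of_nonneg hS0]
  rw [hJmain]
  calc |J c w B ρ χ + Jmain c w B ρ q| ≤ (η * k + A / Real.sqrt (Real.log E)) * scaleS w B ρ q := h
    _ = (η + A / k / Real.sqrt (Real.log E)) * (scaleS w B ρ q * k) := by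
        field_simp

end Literature.NumberTheory.LFunctions.BondarenkoHeap2026
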